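import Summits.ResolutionOfSingularities.ResolutionOfSingularities.Theorems.WildConesCampaignW46HypersurfacesCharTwoSepClosed
import Summits.ResolutionOfSingularities.ResolutionOfSingularities.Theorems.WildConesCampaignW46ThreefoldsCharTwoSplittingRegime

/-!
# [OURS · L1 W4.6, rung (ii) at p = 2, every dimension n, SEPARABLY CLOSED field] THE SIDEWAYS EXIT IS FORCED: over a
# separably closed field of characteristic 2 EVERY isolated double point `z² = a(u₁,…,uₙ)` outside the classes
# `e ≤ 1`, `(2,1)`, `(2,2)` — i.e. with `e ≥ 3` or `(e, h₂) = (2, 3)` — HAS a NON-isolated infinitely-near double point;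
# for THREEFOLDS: every isolated double point of cleaned order `≥ 3` hands a non-isolated double point to the curve phase

HONEST FRAMING. Everything here is OURS: theorems about route WildCones' own TYPED point-blow-up dynamics
(`Theorems/WildConesClassicalRegimesDefs.lean`) and the seat's invariants `milnorEmbDim` (p498937), `milnorHilbertTwo`
(p511581). NOTHING here is a statement of the manuscript [Hironaka2017]; no FACT-LIST premise; AI review is weaker than
expert review. Cell res-hironaka (LADDER-RESOLUTION rung L, D-0089), slot W4.6, seat res-L1-s46-pv-4 (gen 7); host route
`WildCones`, crux `ClassicalRegimes` (stmt-ResolutionOfSingularities-16884; proved).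

THE POINT. Gen 2's scope marker `threefold_exists_sidewaysExit` (p483423) exhibited ONE isolated threefold double point
(the Fermat cubic) leaving the point-blow-up regime sideways into a non-isolated double point; gen 3/4 showed that at
`e ≥ 3` and at `(e, h₂) = (2, 3)` EVERY double successor is non-isolated (p501990, p513980) — but not that one exists.
With gen 7's existence of near points over a separably closed field (`…SepClosed`: a genuine cubic has a root in
characteristic `2`) the exit is FORCED: every such point HAS a double successor, necessarily non-isolated. At `(2,3)`
no hypothesis on the field is needed (every kernel direction is a non-isolated near point, p530584). For threefolds
(`n = 3`: `e ∈ {1, 3}`) this is the complete dichotomy of the point phase over a separably closed field: EITHER the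
state is order-2 cleaned (`e = 1`: the deterministic chain of `μ/2` isolated double points of gens 2–3, every double
successor isolated, order-2 cleaned, `μ' = μ − 2`) OR it has cleaned order `3` (`e = 3`) and then it HAS infinitely-near
double points and ALL of them are non-isolated — the typed procedure must pass to one-dimensional centres; point
blow-ups at isolated double points never finish the job there.

WHAT IS PROVED (`κ` of characteristic `2`; separably closed where marked):

* `hypersurface_exists_nonisolated_successor_of_milnorHilbertTwo_eq_three` — EVERY field, isolated `(2,3)`: a
  non-isolated double successor exists;
* `hypersurface_exists_nonisolated_successor_of_three_le_of_isSepClosed` — sep. closed, isolated, `e ≥ 3`: a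
  non-isolated double successor exists;
* `hypersurface_sideways_forced_of_isSepClosed` — sep. closed, isolated, `e ≥ 3 ∨ (e, h₂) = (2, 3)`: a double
  successor exists AND every double successor is non-isolated;
* `threefold_sideways_forced_of_isSepClosed` — sep. closed, `n = 3`, isolated, cleaned order `≥ 3` (`¬ OrdP`): same;
* `threefold_point_phase_dichotomy_of_isSepClosed` — sep. closed, `n = 3`, isolated double state: the hyperbolic chain
  (every double successor order-2 cleaned, isolated, `μ' + 2 = μ`) OR the forced sideways exit.

References: [GreuelPfister2026] (context); [Hironaka2017] Th. 16.6 p.84 — role replaced only, under adjudication;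
nothing of it is used.
-/

noncomputable section

-- single-problem summit: the doubled namespace component `ResolutionOfSingularities` is forced
set_option linter.dupNamespace false

open scoped BigOperators Classical

open MvPowerSeries IsLocalRing

open Literature.AlgebraicGeometry.Resolution

namespace Summit.ResolutionOfSingularities.ResolutionOfSingularities.Theorems

namespace CampaignW46.HypersurfacesCharTwo

open WildCones WildCones.MuDropCharTwoOrdP ThreefoldsCharTwo

variable {κ : Type} [Field κ] {n : ℕ}

/-- [OURS · L1 W4.6 rung (ii) at `p = 2`, every dimension, EVERY field of characteristic `2`; NOT a statement of the
manuscript] **AT `(e, h₂) = (2, 3)` A NON-ISOLATED INFINITELY-NEAR DOUBLE POINT EXISTS** over the field of definition: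
the kernel of the polar form has a non-zero (rational) vector, which is near with non-isolated successor (p530584).
[folklore] -/
theorem hypersurface_exists_nonisolated_successor_of_milnorHilbertTwo_eq_three [CharP κ 2] (c : (Fin n → ℕ) → κ)
    (hM : MultP 2 n κ c) (hI : Isol 2 n κ c) (he : milnorEmbDim 2 n κ c = 2) (hh : milnorHilbertTwo 2 n κ c = 3) :
    ∃ (i : Fin n) (τ : Fin n → κ), MultP 2 n κ (step 2 n κ i τ c) ∧ ¬ Isol 2 n κ (step 2 n κ i τ c) := by
  obtain ⟨w, hw0, hw⟩ := exists_kernel_ne_zero hM he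
  obtain ⟨i, hi⟩ : ∃ i, w i ≠ 0 := by
    by_contra h
    push Not at h
    exact hw0 (funext h)
  exact ⟨i, _, hypersurface_whole_kernel_near_of_milnorHilbertTwo_eq_three c hM hI he hh hw hi⟩

/-- [OURS · L1 W4.6 rung (ii) at `p = 2`, every dimension, SEPARABLY CLOSED field; NOT a statement of the manuscript]
**AT `e ≥ 3` A NON-ISOLATED INFINITELY-NEAR DOUBLE POINT EXISTS over a separably closed field of characteristic `2`**: a
near point exists (`…SepClosed`, `e ≥ 2`) and every double successor at `e ≥ 3` is non-isolated (p501990). [folklore] -/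
theorem hypersurface_exists_nonisolated_successor_of_three_le_of_isSepClosed [CharP κ 2] [IsSepClosed κ]
    (c : (Fin n → ℕ) → κ) (hM : MultP 2 n κ c) (hI : Isol 2 n κ c) (he : 3 ≤ milnorEmbDim 2 n κ c) :
    ∃ (i : Fin n) (τ : Fin n → κ), MultP 2 n κ (step 2 n κ i τ c) ∧ ¬ Isol 2 n κ (step 2 n κ i τ c) := by
  obtain ⟨i, τ, hM'⟩ := hypersurface_exists_double_successor_of_isSepClosed c hM hI (by omega)
  exact ⟨i, τ, hM', hypersurface_not_isol_step_of_three_le c i τ hM he hM'⟩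

/-- [OURS · L1 W4.6 rung (ii) at `p = 2`, EVERY dimension `n`, SEPARABLY CLOSED field of characteristic `2`; NOT a
statement of the manuscript] **THE SIDEWAYS EXIT IS FORCED**: an isolated double state of `z² = a(u₁,…,uₙ)` over a
separably closed field with `e(c) ≥ 3` or `(e, h₂) = (2, 3)` HAS a chart/translation with a double successor, and EVERY
double successor is NON-isolated — outside the classes `e ≤ 1`, `(2,1)`, `(2,2)` (where all double successors are
isolated, gens 3–4) the chain of isolated double points cannot be continued by point blow-ups, and it does not simply
stop either. [folklore] -/
theorem hypersurface_sideways_forced_of_isSepClosed [CharP κ 2] [IsSepClosed κ] (c : (Fin n → ℕ) → κ)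
    (hM : MultP 2 n κ c) (hI : Isol 2 n κ c)
    (h : 3 ≤ milnorEmbDim 2 n κ c ∨ (milnorEmbDim 2 n κ c = 2 ∧ milnorHilbertTwo 2 n κ c = 3)) :
    (∃ (i : Fin n) (τ : Fin n → κ), MultP 2 n κ (step 2 n κ i τ c) ∧ ¬ Isol 2 n κ (step 2 n κ i τ c)) ∧
      ∀ (i : Fin n) (τ : Fin n → κ), MultP 2 n κ (step 2 n κ i τ c) → ¬ Isol 2 n κ (step 2 n κ i τ c) := by
  rcases h with h3 | ⟨he, hh⟩
  · exact ⟨hypersurface_exists_nonisolated_successor_of_three_le_of_isSepClosed c hM hI h3,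
      fun i τ hM' => hypersurface_not_isol_step_of_three_le c i τ hM h3 hM'⟩
  · exact ⟨hypersurface_exists_nonisolated_successor_of_milnorHilbertTwo_eq_three c hM hI he hh,
      fun i τ hM' => hypersurface_not_isol_step_of_milnorHilbertTwo_eq_three c i τ hM he hh hM'⟩

/-! ## Threefolds -/

/-- [OURS · L1 W4.6 rung (ii) at `p = 2`, THREEFOLDS (`n = 3`), SEPARABLY CLOSED field of characteristic `2`; NOT a
statement of the manuscript] **EVERY ISOLATED THREEFOLD DOUBLE POINT OF CLEANED ORDER `≥ 3` EXITS SIDEWAYS**: an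
isolated double state of `z² = a(u₀,u₁,u₂)` that is NOT order-2 cleaned (no hyperbolic pair; `e = 3`) over a separably
closed field HAS an infinitely-near double point, and every infinitely-near double point is NON-isolated. Gen 2's
`threefold_exists_sidewaysExit` (the Fermat cubic, p483423) is the generic behaviour, not an exception. [folklore] -/
theorem threefold_sideways_forced_of_isSepClosed [CharP κ 2] [IsSepClosed κ] (c : (Fin 3 → ℕ) → κ)
    (hM : MultP 2 3 κ c) (hI : Isol 2 3 κ c) (hO : ¬ OrdP 2 3 κ c) :
    (∃ (i : Fin 3) (τ : Fin 3 → κ), MultP 2 3 κ (step 2 3 κ i τ c) ∧ ¬ Isol 2 3 κ (step 2 3 κ i τ c)) ∧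
      ∀ (i : Fin 3) (τ : Fin 3 → κ), MultP 2 3 κ (step 2 3 κ i τ c) → ¬ Isol 2 3 κ (step 2 3 κ i τ c) :=
  hypersurface_sideways_forced_of_isSepClosed c hM hI (Or.inl (by rw [(threefold_milnorEmbDim_eq hM).2 hO]))

/-- [OURS · L1 W4.6 rung (ii) at `p = 2`, THREEFOLDS (`n = 3`), SEPARABLY CLOSED field of characteristic `2`; NOT a
statement of the manuscript] **THE POINT-PHASE DICHOTOMY FOR THREEFOLD DOUBLE POINTS over a separably closed field**: an
isolated double state of `z² = a(u₀,u₁,u₂)` is EITHER order-2 cleaned — then every double successor is again order-2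
cleaned and isolated with `μ' + 2 = μ` (the deterministic hyperbolic chain of gens 2–3, ending at a smooth point after
`μ/2` blow-ups) — OR of cleaned order `3`, and then it HAS infinitely-near double points, ALL non-isolated: the typed
procedure must continue with one-dimensional centres. [folklore] -/
theorem threefold_point_phase_dichotomy_of_isSepClosed [CharP κ 2] [IsSepClosed κ] (c : (Fin 3 → ℕ) → κ)
    (hM : MultP 2 3 κ c) (hI : Isol 2 3 κ c) :
    (OrdP 2 3 κ c ∧ ∀ (i : Fin 3) (τ : Fin 3 → κ), MultP 2 3 κ (step 2 3 κ i τ c) →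
        OrdP 2 3 κ (step 2 3 κ i τ c) ∧ Isol 2 3 κ (step 2 3 κ i τ c) ∧
          mu 2 3 κ (step 2 3 κ i τ c) + 2 = mu 2 3 κ c) ∨
      (¬ OrdP 2 3 κ c ∧
        (∃ (i : Fin 3) (τ : Fin 3 → κ), MultP 2 3 κ (step 2 3 κ i τ c) ∧ ¬ Isol 2 3 κ (step 2 3 κ i τ c)) ∧
        ∀ (i : Fin 3) (τ : Fin 3 → κ), MultP 2 3 κ (step 2 3 κ i τ c) → ¬ Isol 2 3 κ (step 2 3 κ i τ c)) := by
  by_cases hO : OrdP 2 3 κ c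
  · exact Or.inl ⟨hO, fun i τ hM' => threefold_regime_step c i τ hM hO hI hM'⟩
  · exact Or.inr ⟨hO, threefold_sideways_forced_of_isSepClosed c hM hI hO⟩

end CampaignW46.HypersurfacesCharTwo

end Summit.ResolutionOfSingularities.ResolutionOfSingularities.Theorems

end
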